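import Summits.QuantumFields.BalabanUV.Beta.GAN24.NestedBackgroundTadpoleEnd
import Summits.QuantumFields.BalabanUV.Beta.GAN24.TentBackgroundLegs

/-!
# `BalabanUV.Beta.GAN24.NestedBlockIndicatorLegs` — binder row G-an2-4 ∕ (CONV-C), routes C-R6° («VALUES») × R7 («TWO CURRENCIES»), PART 224:
# THE EXPLICIT NESTED INSTANCE — ROW an1's COORDINATE 1-FORMS `V_{t,x}^{(k)}(u)_μ = [μ = x₂]·𝟙[block_k(u) = x₁]` (the indicator of the UNIT BLOCK of `x₁` read on the lattice of
# spacing `L^{−k}`, `block_k = prtk (prtQ L M) k` NE2's iterated block parent) ARE A BOUNDED, EXACTLY NESTED, LOCALISED SINGLE-DIRECTION FAMILY WITH POINTWISE LIMITS ABOUT EVERY INTEGER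
# ROOT — so PARTs 219–223's nested-background ENDs hold for them WITH NOTHING DISPLAYED; and V196's ONE-LOOP CONTRACTION `Γ_k(Y_k ⊗ₖ Y_k)Γ_kᴴ` (PART 200's shape) HAS THE WHOLE `LimitRate`
# END FOR EVERY BOUNDED NESTED FAMILY (PART 220 §1's envelopes + PART 213 §3's EL₃ + PART 197) AND FOR THE BLOCK INDICATORS (census V204′ (i); unit b2b-balaban-gan24-p3, gen 64; v1)

NOT IN PRINT; OUR PROOF ([folklore] bookkeeping BY NAME over NE2's `CTKingTowerWeights` (`val_prtk`, `tdist_ctr_bounds`, `toM`, `ctr`, `rho_apply`), `BlockSumDecay` (`prtk`, `prtQ`),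
`BalabanAveragedTowerModes.par_cpt_add_off`, `BalabanAveragedCoerciveTower` (`unitIdx`, `unitSites`), PART 186 (`cpt_castT_add_off`), PART 126 (`toM_eq_unitSites`), PART 139's window lemma
`eventually_castT_eq_castT_iff`, PART 202 §1 (`unitIdx_symm_fst ∕ _snd`), PART 220 (`nestedLegs_envelopes`), PART 213 (`boundedLegs_tendsto`), PART 197 (`conv_oneLoop_loopCov_moving_of_rate`);
[Balaban1987RG1] (1.20)–(1.22) p. 264 LOCATE the one-loop shape; [King1986] (2.10) p. 653 the block parent; nothing printed is a hypothesis).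
HONEST FRAMING (cell contract, verbatim): «discharging `BetaPertH` makes Bałaban's UV stability UNCONDITIONAL — a real constructive-QFT result; it is NOT the
continuum limit and NOT the Clay problem.»  HONEST DEPENDENCY (verbatim): «continuum YM on T⁴ ⇐ BetaPertH ∧ nine spine estimates (0/9 proved); BetaPertH ⇐
(D1) ∧ (D4) ∧ CAP+tail; G-an2-4 gates asym, D1 and NE2/3/4.»

WHAT THIS FILE PROVES (0 sorry, 0 `def`; `n_k = lev L k`, `e = unitIdx⁻¹`, `ẑ = castT · z`; the block-indicator family DISPLAYED as the hypothesis
`hVdef : ∀ t x k μ u, V t x k μ u = [μ = x₂]·𝟙[(prtk (prtQ L M_t) k u)₁ = x₁]`, no definition introduced):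
* §1 INTEGER READINGS OF THE BLOCK PARENT: **`par_castT`** (`par ŵ = ⌊w∕R⌋^` on every two-level pair, PART 192's `par_castT_fine` at general `N`), **`prtk_prtQ_castT`**
  (`prtk k (ŵ, f) = (⌊w∕n_k⌋^, f)` — iterated floor division, `Int.ediv_ediv_of_nonneg`), **`toM_castT`**, **`unitIdx_symm_castT_fst`** (`(e(ẑ, μ′))₁ = ẑ` on level `0`),
  **`rho_nonpos_of_prtk_fst`** (NE2's (G2a) with the site component only: `(prtk u)₁ = y₁ ⟹ ρ_{k,y}(u) ≤ 0`).
* §2 THE BLOCK-INDICATOR FAMILY along ANY cubic side sequence: **`blockIndicator_bound`** (`‖V‖ ≤ 1`), **`blockIndicator_dir`** (single direction `x₂`), **`blockIndicator_nest`**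
  (EXACT nesting `V^{(k+1)}_{x₂} = V^{(k)}_{x₂} ∘ parT`, by `rfl`: `prtk (k+1) = prtk k ∘ prtQ k` and `prtQ k = parT n_k`), **`blockIndicator_loc`** (supported where `ρ_{k,x} ≤ 0`),
  **`tendsto_blockIndicator_reading`** (EL₁: the reading `V_{t,e(ẑ,μ′)}^{(k)}{}_μ(ŵ, f)` is eventually the constant `[μ = μ′]·[⌊w∕n_k⌋ = z]`).
* §3 **`conv_oneLoop_loopCov_nestedLegs`** — V196's ONE-LOOP CONTRACTION END (PART 200's statement: `IsInfiniteVolumeLimit (Lb·1·2(t+1))`, `UniformDecay`, `StepRate √(L⁻¹)`, `KernelInputs`,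
  second moments) for EVERY bounded, exactly nested, localised single-direction family with pointwise limits — NO Lipschitz letter (`d + 1 ≥ 3`, `L ≥ 2`, every `Lb ≥ 1`, `a > 0`, `μ ≠ ν`);
  **`conv_oneLoop_loopCov_blockIndicatorLegs`** — the same for the block-indicator family with NOTHING displayed but `hVdef`.
WHAT IT DOES NOT DO: the identification with Bałaban's `Π⁰` ∕ the coefficient vector (row an1's); non-nested profiles (the `ρ ≤ 0` balls of PART 213 §4); a value for any constant.
SUPPLIER work; NEVER «G-an2-4 closed»; NOT (CONV-C), NOT D1, NOT `BetaPertH`, NOT continuum, NOT Clay.  Records: `HOME/b2b-balaban-gan24-p3/gen64/README.md`.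
-/

noncomputable section

open scoped BigOperators ComplexConjugate Matrix Matrix.Norms.L2Operator Kronecker
open Filter Topology Finset Matrix

namespace Summit.QuantumFields.BalabanUV.Beta.GAN24.NestedBlockIndicatorLegs

open Literature.MathematicalPhysics.QuantumFieldTheory.Balaban1983to89
open Literature.MathematicalPhysics.QuantumFieldTheory.Balaban1983to89.B5Prop11Plancherel (Tor fine)
open Literature.MathematicalPhysics.QuantumFieldTheory.Balaban1983to89.B5RealFields (reM)
open Literature.MathematicalPhysics.QuantumFieldTheory.Balaban1983to89.B5G183RateUnitTower (lev)
open Literature.MathematicalPhysics.QuantumFieldTheory.Balaban1983to89.B5G183RateTorus (cpt)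
open Literature.MathematicalPhysics.QuantumFieldTheory.Balaban1983to89.B5G183RateTorusW (off)
open Literature.MathematicalPhysics.QuantumFieldTheory.Balaban1983to89.B12Sec2to5 (betaPrime510)
open Literature.MathematicalPhysics.QuantumFieldTheory.Balaban1983to89.Beta (IsInfiniteVolumeLimit)
open Literature.MathematicalPhysics.QuantumFieldTheory.Balaban1983to89.Beta.FreeLegDictionary (cubic)
open Literature.MathematicalPhysics.QuantumFieldTheory.Balaban1983to89.Beta.BlockKernelVolumeSockets (evenPeriod tendsto_evenPeriod)
open Literature.MathematicalPhysics.QuantumFieldTheory.Balaban1983to89.Beta.VectorTails (castT)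
open Literature.MathematicalPhysics.QuantumFieldTheory.Balaban1983to89.Beta.VectorTailsCov (tdist tdist_self)
open Literature.MathematicalPhysics.QuantumFieldTheory.Balaban1983to89.Beta.LimitRate (StepRate limKernelOf KernelInputs)
open Literature.MathematicalPhysics.QuantumFieldTheory.Balaban1983to89.Beta.CompositionSingular (flucCov)
open Literature.MathematicalPhysics.QuantumFieldTheory.Balaban1983to89.Beta.BlockEffectiveAction (DelK)
open Summit.QuantumFields.BalabanUV.T4Continuum.BalabanLineAverage (QB)
open Summit.QuantumFields.BalabanUV.T4Continuum.BalabanAveragedTowerModes (par rem par_cpt_add_off)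
open Summit.QuantumFields.BalabanUV.T4Continuum.CovariantAveragingTower (avgTow)
open Summit.QuantumFields.BalabanUV.T4Continuum.BalabanAveragedTowerUnit (idx QBlev calGlev unitCovB one_le_lev')
open Summit.QuantumFields.BalabanUV.T4Continuum.BalabanAveragedCoerciveTower (unitIdx unitSites)
open Summit.QuantumFields.BalabanUV.T4Continuum.BlockPairingGeometry (parT)
open Summit.QuantumFields.BalabanUV.T4Continuum.BlockSumDecay (prtk prtQ)
open Summit.QuantumFields.BalabanUV.T4Continuum.CTKingTowerWeights (rho rhoSite ctr toM rho_apply distK tdist_ctr_bounds)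
open Summit.QuantumFields.BalabanUV.T4Continuum.FirstOrderBackgroundModel (Pmodel)
open Summit.QuantumFields.BalabanUV.Beta.GAN24.InsertionChainDecayBalaban (toM_eq_unitSites)
open Summit.QuantumFields.BalabanUV.Beta.GAN24.OneStepConstraintBlockPresentation (cpt_castT_add_off)
open Summit.QuantumFields.BalabanUV.Beta.GAN24.VolumeLimitPairsRect (eventually_castT_eq_castT_iff)
open Summit.QuantumFields.BalabanUV.Beta.GAN24.TentBackgroundLegs (unitIdx_symm_fst unitIdx_symm_snd)
open Summit.QuantumFields.BalabanUV.Beta.GAN24.OneStepLoopContractionMovingLegs (conv_oneLoop_loopCov_moving_of_rate)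
open Summit.QuantumFields.BalabanUV.Beta.GAN24.BoundedBackgroundLegs (boundedLegs_tendsto)
open Summit.QuantumFields.BalabanUV.Beta.GAN24.NestedBackgroundLoopEnd (nestedLegs_envelopes)

variable {d : ℕ} (L : ℕ) [NeZero L]

/-! ## §1 Integer readings of the block parent and of its iterate -/

section Parent

variable {D : ℕ} (N R : ℕ) [NeZero N] [NeZero R] (M : Fin D → ℕ) [hM : ∀ μ, NeZero (M μ)]

omit [NeZero L] in
/-- **`par_castT`** — `par ŵ = ⌊w∕R⌋^` on every two-level pair `(N, R·N)`: the block parent of the reading of an integer vector is the reading of its block coordinate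
(PART 186 `cpt_castT_add_off` + `w = R·⌊w∕R⌋ + w mod R` + NE2's `par_cpt_add_off`; PART 192's `par_castT_fine` is the case `N = 1`). [cite: King1986, (2.10) p.653 (block parent)]
[folklore] -/
theorem par_castT (w : Fin D → ℤ) :
    par N R M (castT (fine (R * N) M) w) = castT (fine N M) (fun ν => w ν / (R : ℤ)) := by
  have hR : (0 : ℤ) < R := by exact_mod_cast Nat.pos_of_ne_zero (NeZero.ne R)
  have e : castT (fine (R * N) M) w = cpt N R M (castT (fine N M) (fun ν => w ν / (R : ℤ))) +
      off N R M (fun ν => (⟨(w ν % (R : ℤ)).toNat, by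
        have h1 := Int.emod_lt_of_pos (w ν) hR
        have h0 := Int.emod_nonneg (w ν) hR.ne'
        omega⟩ : Fin R)) := by
    rw [cpt_castT_add_off]
    congr 1
    funext ν
    have h0 := Int.emod_nonneg (w ν) hR.ne'
    rw [Int.toNat_of_nonneg h0, Int.emod_def]
    ring
  rw [e, par_cpt_add_off]

end Parent

section Tower

variable {D : ℕ} (M : Fin D → ℕ) [hM : ∀ μ, NeZero (M μ)]

/-- **`prtk_prtQ_castT`** — THE ITERATED BLOCK PARENT OF AN INTEGER READING: `prtk k (ŵ, f) = (⌊w∕n_k⌋^, f)` (`prtk (k+1) = prtk k ∘ prtQ k`, `prtQ k = (par n_k, ·)`, §1's `par_castT`,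
`⌊⌊w∕L⌋∕n_k⌋ = ⌊w∕(L·n_k)⌋`). [folklore] -/
theorem prtk_prtQ_castT : ∀ (k : ℕ) (w : Fin D → ℤ) (f : Fin D),
    prtk (prtQ L M) k (castT (fine (lev L k) M) w, f) = (castT (fine (lev L 0) M) (fun ν => w ν / ((lev L k : ℕ) : ℤ)), f)
  | 0, w, f => by
      have h : (fun ν => w ν / ((lev L 0 : ℕ) : ℤ)) = w := by
        funext ν; simp [lev]
      rw [h]; rfl
  | k + 1, w, f => by
      have hL0 : (0 : ℤ) ≤ (L : ℤ) := by positivity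
      rw [show prtk (prtQ L M) (k + 1) (castT (fine (lev L (k + 1)) M) w, f)
          = prtk (prtQ L M) k (par (lev L k) L M (castT (fine (L * lev L k) M) w), f) from rfl, par_castT, prtk_prtQ_castT k]
      refine Prod.ext ?_ rfl
      show castT (fine (lev L 0) M) (fun ν => (w ν / (L : ℤ)) / ((lev L k : ℕ) : ℤ)) = castT (fine (lev L 0) M) (fun ν => w ν / ((lev L (k + 1) : ℕ) : ℤ))
      congr 1
      funext ν
      rw [Int.ediv_ediv_of_nonneg hL0, show lev L (k + 1) = L * lev L k from rfl, Nat.cast_mul]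

/-- **`toM_castT`** — the level-`0` reading of an integer vector READ IN `Tor M` is its reading there (`ZMod.cast_intCast`, `M_ν ∣ n_0·M_ν`). [folklore] -/
theorem toM_castT (z : Fin D → ℤ) : toM L M (castT (fine (lev L 0) M) z) = castT M z := by
  funext ν
  show (((castT (fine (lev L 0) M) z ν).val : ℕ) : ZMod (M ν)) = ((z ν : ℤ) : ZMod (M ν))
  simp only [castT]
  rw [ZMod.natCast_val, ZMod.cast_intCast (dvd_mul_left (M ν) (lev L 0))]

/-- **`unitIdx_symm_castT_fst`** — `(e(ẑ, μ′))₁ = ẑ` READ ON LEVEL `0`: the site of the integer root is the level-`0` reading of `z` (PART 202's `unitIdx_symm_fst`, PART 126's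
`toM_eq_unitSites`, `toM_castT`). [folklore] -/
theorem unitIdx_symm_castT_fst (z : Fin D → ℤ) (μ' : Fin D) :
    ((unitIdx L M).symm (castT M z, μ')).1 = castT (fine (lev L 0) M) z := by
  rw [unitIdx_symm_fst]
  refine ((unitSites M).symm_apply_eq).mpr ?_
  rw [← toM_eq_unitSites (L := L), toM_castT]

/-- **`rho_nonpos_of_prtk_fst`** — NE2's (G2a) WITH THE SITE COMPONENT ONLY: `(prtk u)₁ = y₁ ⟹ ρ_{k,y}(u) ≤ 0` (`tdist_ctr_bounds`: the fine distance to the corner of the block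
of `y` is at most `n_k − 1` on that block). [folklore] -/
theorem rho_nonpos_of_prtk_fst (k : ℕ) (y : idx L M 0) (u : idx L M k) (hu : (prtk (prtQ L M) k u).1 = y.1) : rho L M k y u ≤ 0 := by
  have hn1 : 1 ≤ lev L k := one_le_lev' L k
  have hn : (0 : ℝ) < (lev L k : ℝ) := by exact_mod_cast hn1
  have h := (tdist_ctr_bounds L M k y u).1
  rw [hu, tdist_self, mul_zero, zero_add] at h
  have h' : (tdist (ctr L M k y) u.1 : ℝ) ≤ (lev L k : ℝ) - 1 := by
    have := (Nat.cast_le (α := ℝ)).mpr h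
    rw [Nat.cast_sub hn1, Nat.cast_one] at this
    exact this
  rw [rho_apply]
  unfold rhoSite
  rw [sub_nonpos, div_le_one hn]
  linarith

end Tower

/-! ## §2 The block-indicator family: bounded by `1`, one direction, exactly nested, supported on the centre block, pointwise limits about integer roots -/

section Indicator

variable {D : ℕ} {side : ℕ → ℕ} [hs : ∀ t, NeZero (side t)]

omit [NeZero L] hs in
/-- the block-indicator family is bounded by `1`. [folklore] -/
theorem blockIndicator_bound {V : (t : ℕ) → idx L (cubic D (side t)) 0 → (k : ℕ) → Fin D → (idx L (cubic D (side t)) k → ℂ)}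
    (hVdef : ∀ t x k μ u, V t x k μ u = if μ = x.2 then (if (prtk (prtQ L (cubic D (side t))) k u).1 = x.1 then 1 else 0) else 0) (t : ℕ) (x : idx L (cubic D (side t)) 0)
    (k : ℕ) (μ : Fin D) (u : idx L (cubic D (side t)) k) : ‖V t x k μ u‖ ≤ 1 := by
  rw [hVdef]; split_ifs <;> simp

omit [NeZero L] hs in
/-- the block-indicator family has the single direction `x₂`. [folklore] -/
theorem blockIndicator_dir {V : (t : ℕ) → idx L (cubic D (side t)) 0 → (k : ℕ) → Fin D → (idx L (cubic D (side t)) k → ℂ)}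
    (hVdef : ∀ t x k μ u, V t x k μ u = if μ = x.2 then (if (prtk (prtQ L (cubic D (side t))) k u).1 = x.1 then 1 else 0) else 0) (t : ℕ) (x : idx L (cubic D (side t)) 0)
    (k : ℕ) (μ : Fin D) (u : idx L (cubic D (side t)) k) (h : μ ≠ x.2) : V t x k μ u = 0 := by
  rw [hVdef, if_neg h]

omit [NeZero L] hs in
/-- **`blockIndicator_nest` — EXACT NESTING** `V^{(k+1)}_{x₂}(u) = V^{(k)}_{x₂}(parT u)`: `prtk (k+1) u = prtk k (prtQ k u)` and `prtQ k = parT n_k` hold by `rfl`. [cite: King1986, (2.10) p.653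
(block parent)] [folklore] -/
theorem blockIndicator_nest {V : (t : ℕ) → idx L (cubic D (side t)) 0 → (k : ℕ) → Fin D → (idx L (cubic D (side t)) k → ℂ)}
    (hVdef : ∀ t x k μ u, V t x k μ u = if μ = x.2 then (if (prtk (prtQ L (cubic D (side t))) k u).1 = x.1 then 1 else 0) else 0) (t : ℕ) (x : idx L (cubic D (side t)) 0)
    (k : ℕ) (u : idx L (cubic D (side t)) (k + 1)) : V t x (k + 1) x.2 u = V t x k x.2 (parT (lev L k) L (cubic D (side t)) u) := by
  rw [hVdef, hVdef]; rfl

/-- **`blockIndicator_loc`** — the block-indicator family is supported where `ρ_{k,x} ≤ 0` (§1's `rho_nonpos_of_prtk_fst`). [folklore] -/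
theorem blockIndicator_loc {V : (t : ℕ) → idx L (cubic D (side t)) 0 → (k : ℕ) → Fin D → (idx L (cubic D (side t)) k → ℂ)}
    (hVdef : ∀ t x k μ u, V t x k μ u = if μ = x.2 then (if (prtk (prtQ L (cubic D (side t))) k u).1 = x.1 then 1 else 0) else 0) (t : ℕ) (x : idx L (cubic D (side t)) 0)
    (k : ℕ) (μ : Fin D) (u : idx L (cubic D (side t)) k) (h : V t x k μ u ≠ 0) : rho L (cubic D (side t)) k x u ≤ 0 := by
  rw [hVdef] at h
  by_cases hμ : μ = x.2
  · rw [if_pos hμ] at h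
    by_cases hb : (prtk (prtQ L (cubic D (side t))) k u).1 = x.1
    · exact rho_nonpos_of_prtk_fst L (cubic D (side t)) k x u hb
    · exact absurd (if_neg hb) h
  · exact absurd (if_neg hμ) h

/-- **`tendsto_blockIndicator_reading` — EL₁ OF THE BLOCK-INDICATOR FAMILY ABOUT INTEGER ROOTS** [our proof] (ANY cubic side sequence `side t → ∞`): for all integer `z, w`, all
`μ′, k, μ, f`, the reading `V_{t,e(ẑ_t,μ′)}^{(k)}{}_μ(ŵ_t, f)` converges — by §1 it is `[μ = μ′]·[⌊w∕n_k⌋^ = ẑ]` on the level-`0` torus of side `n_0·side t`, and fixed integer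
vectors are eventually separated there (PART 139's `eventually_castT_eq_castT_iff`), so it is eventually the constant `[μ = μ′]·[⌊w∕n_k⌋ = z]`. [folklore] -/
theorem tendsto_blockIndicator_reading (hside : Tendsto side atTop atTop)
    {V : (t : ℕ) → idx L (cubic D (side t)) 0 → (k : ℕ) → Fin D → (idx L (cubic D (side t)) k → ℂ)}
    (hVdef : ∀ t x k μ u, V t x k μ u = if μ = x.2 then (if (prtk (prtQ L (cubic D (side t))) k u).1 = x.1 then 1 else 0) else 0)
    (z : Fin D → ℤ) (μ' : Fin D) (k : ℕ) (μ f : Fin D) (w : Fin D → ℤ) :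
    ∃ s : ℂ, Tendsto (fun t => V t ((unitIdx L (cubic D (side t))).symm (castT (cubic D (side t)) z, μ')) k μ
      (castT (fine (lev L k) (cubic D (side t))) w, f)) atTop (𝓝 s) := by
  by_cases hμ : μ = μ'
  · refine ⟨if (fun ν => w ν / ((lev L k : ℕ) : ℤ)) = z then 1 else 0, tendsto_const_nhds.congr' ?_⟩
    filter_upwards [eventually_castT_eq_castT_iff (d := D) hside (lev L 0) (one_le_lev' L 0) (fun ν => w ν / ((lev L k : ℕ) : ℤ)) z] with t ht
    have ht' : (castT (fine (lev L 0) (cubic D (side t))) (fun ν => w ν / ((lev L k : ℕ) : ℤ)) = castT (fine (lev L 0) (cubic D (side t))) z ↔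
        (fun ν => w ν / ((lev L k : ℕ) : ℤ)) = z) := ht
    rw [hVdef, unitIdx_symm_snd, if_pos hμ, prtk_prtQ_castT, unitIdx_symm_castT_fst]
    dsimp only
    by_cases hz : (fun ν => w ν / ((lev L k : ℕ) : ℤ)) = z
    · rw [if_pos hz, if_pos (ht'.mpr hz)]
    · rw [if_neg hz, if_neg (fun h => hz (ht'.mp h))]
  · exact ⟨0, tendsto_const_nhds.congr fun t => by rw [hVdef, unitIdx_symm_snd, if_neg hμ]⟩

end Indicator

/-! ## §3 V196's one-loop contraction END for nested bounded families and for the block indicators -/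

variable (Lb : ℕ) [NeZero Lb] (a : ℝ) (ha : 0 < a)

/-- **`conv_oneLoop_loopCov_nestedLegs` — V196's ONE-LOOP CONTRACTION END FOR EVERY BOUNDED, EXACTLY NESTED, LOCALISED SINGLE-DIRECTION FAMILY WITH POINTWISE LIMITS**
[our proof] (`d + 1 ≥ 3`, `L ≥ 2`, every `Lb ≥ 1`, `a > 0`, `μ ≠ ν`, coarse volumes `2(t+1)`, `M_t = fine (Lb·1) (cubic (2(t+1)))`; NO Lipschitz letter): the one-loop contraction
`Γ_{t,k}(Y_{t,k} ⊗ₖ Y_{t,k})Γ_{t,k}ᴴ` of the gauge-fixed loop covariance `Y = c⁻¹𝒢c⁻¹` with the insertion-word legs `Γ_{t,k}(x,(q,r)) = X_{t,x,k}(q,r)` has the whole `LimitRate` END on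
`ℤ^{d+1}` — PART 200's statement and proof with PART 220 §1's (L-UD)+(L-SR) (`nestedLegs_envelopes`, ratio `√(L⁻¹)`, from the PLANTED word law) in place of PART 198's Lipschitz envelopes
and PART 213 §3's EL₃ (`boundedLegs_tendsto`, the level-slice trick) in place of PART 199's, fed to PART 197's `conv_oneLoop_loopCov_moving_of_rate` (`s = evenPeriod`).
[cite: Balaban1987RG1, (1.20)–(1.22) p.264 (shapes)] -/
theorem conv_oneLoop_loopCov_nestedLegs (hL : 2 ≤ L) (hd : 2 ≤ d) {μ ν : Fin (d + 1)} (hne : μ ≠ ν) {α c₀ : ℝ} (hα : 0 ≤ α)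
    {V : (t : ℕ) → idx L (fine (Lb * 1) (cubic (d + 1) (evenPeriod t))) 0 → (k : ℕ) → Fin (d + 1) → (idx L (fine (Lb * 1) (cubic (d + 1) (evenPeriod t))) k → ℂ)}
    (hVb : ∀ t i k μ u, ‖V t i k μ u‖ ≤ α)
    (hdir : ∀ t (i : idx L (fine (Lb * 1) (cubic (d + 1) (evenPeriod t))) 0) k μ u, μ ≠ i.2 → V t i k μ u = 0)
    (hnest : ∀ t (i : idx L (fine (Lb * 1) (cubic (d + 1) (evenPeriod t))) 0) k (u : idx L (fine (Lb * 1) (cubic (d + 1) (evenPeriod t))) (k + 1)), V t i (k + 1) i.2 u = V t i k i.2 (parT (lev L k) L (fine (Lb * 1) (cubic (d + 1) (evenPeriod t))) u))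
    (hloc : ∀ t i k μ u, V t i k μ u ≠ 0 → rho L (fine (Lb * 1) (cubic (d + 1) (evenPeriod t))) k i u ≤ c₀)
    (hel : ∀ (z : Fin (d + 1) → ℤ) (μ' : Fin (d + 1)) (k : ℕ) (μ f : Fin (d + 1)) (w : Fin (d + 1) → ℤ), ∃ s : ℂ,
      Tendsto (fun t => V t ((unitIdx L (fine (Lb * 1) (cubic (d + 1) (evenPeriod t)))).symm (castT (fine (Lb * 1) (cubic (d + 1) (evenPeriod t))) z, μ')) k μ (castT (fine (lev L k) (fine (Lb * 1) (cubic (d + 1) (evenPeriod t)))) w, f)) atTop (𝓝 s)) :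
    ∃ κ₁ C C' : ℝ, 0 < κ₁ ∧ 0 ≤ C ∧ 0 ≤ C' ∧ ∃ Pinf : ℕ → B12Beta.Kernel (d + 1),
      (∀ k, IsInfiniteVolumeLimit (fun t => Lb * 1 * evenPeriod t)
        (fun t μ' ν' (z : Beta.Site (d + 1) (Lb * 1 * evenPeriod t)) => (((Matrix.of fun (x : idx L (fine (Lb * 1) (cubic (d + 1) (evenPeriod t))) 0) (q : idx L (fine (Lb * 1) (cubic (d + 1) (evenPeriod t))) 0 × idx L (fine (Lb * 1) (cubic (d + 1) (evenPeriod t))) 0) => avgTow (QBlev L (fine (Lb * 1) (cubic (d + 1) (evenPeriod t)))) ((L : ℝ) ^ (d + 1)) (fun k => calGlev L (fine (Lb * 1) (cubic (d + 1) (evenPeriod t))) a ha k * Pmodel L (fine (Lb * 1) (cubic (d + 1) (evenPeriod t))) (V t x) k * calGlev L (fine (Lb * 1) (cubic (d + 1) (evenPeriod t))) a ha k) k q.1 q.2) * ((((unitCovB L (fine (Lb * 1) (cubic (d + 1) (evenPeriod t))) a ha k)⁻¹ * (((flucCov (reM (DelK (lev L k) (one_le_lev' L k) (fine (Lb * 1)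 (cubic (d + 1) (evenPeriod t))) a ha)) (Matrix.fromRows (reM (QB 1 Lb (cubic (d + 1) (evenPeriod t)))) (fun (t' : {x : Tor (fine (Lb * 1) (cubic (d + 1) (evenPeriod t))) × Fin (d + 1) // (∀ ν, ν < x.2 → ((rem 1 Lb (cubic (d + 1) (evenPeriod t)) x.1 ν : ℕ)) = 0) ∧ ((rem 1 Lb (cubic (d + 1) (evenPeriod t)) x.1 x.2 : ℕ)) + 1 < Lb}) (x : Tor (fine (Lb * 1) (cubic (d + 1) (evenPeriod t))) × Fin (d + 1)) => if x = (Function.Embedding.subtype (fun x : Tor (fine (Lb * 1) (cubic (d + 1) (evenPeriod t))) × Fin (d + 1) => (∀ ν, ν < x.2 → ((rem 1 Lb (cubic (d + 1) (evenPeriod t)) x.1 ν : ℕ)) = 0) ∧ ((rem 1 Lb (cubic (d + 1) (evenPeriod t)) x.1 x.2 : ℕ)) + 1 < Lb)) t' then (1 : ℝ) else 0))).map ((↑) : ℝ → ℂ)).submatrix (unitIdx L (fine (Lb * 1) (cubic (d + 1) (evenPeriod t)))) (unitIdx L (fine (Lb * 1) (cubic (d + 1) (evenPeriod t))))) * (unitCovB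 L (fine (Lb * 1) (cubic (d + 1) (evenPeriod t))) a ha k)⁻¹)) ⊗ₖ (((unitCovB L (fine (Lb * 1) (cubic (d + 1) (evenPeriod t))) a ha k)⁻¹ * (((flucCov (reM (DelK (lev L k) (one_le_lev' L k) (fine (Lb * 1) (cubic (d + 1) (evenPeriod t))) a ha)) (Matrix.fromRows (reM (QB 1 Lb (cubic (d + 1) (evenPeriod t)))) (fun (t' : {x : Tor (fine (Lb * 1) (cubic (d + 1) (evenPeriod t))) × Fin (d + 1) // (∀ ν, ν < x.2 → ((rem 1 Lb (cubic (d + 1) (evenPeriod t)) x.1 ν : ℕ)) = 0) ∧ ((rem 1 Lb (cubic (d + 1) (evenPeriod t)) x.1 x.2 : ℕ)) + 1 < Lb}) (x : Tor (fine (Lb * 1) (cubic (d + 1) (evenPeriod t))) × Fin (d + 1)) => if x = (Function.Embedding.subtype (fun x : Tor (fine (Lb * 1) (cubic (d + 1) (evenPeriod t))) × Fin (d + 1) => (∀ ν, ν < x.2 → ((rem 1 Lb (cubic (d + 1) (evenPeriod t)) x.1 ν : ℕ)) = 0) ∧ ((rem 1 Lb (cubic (d + 1) (evenPeriod t)) x.1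 x.2 : ℕ)) + 1 < Lb)) t' then (1 : ℝ) else 0))).map ((↑) : ℝ → ℂ)).submatrix (unitIdx L (fine (Lb * 1) (cubic (d + 1) (evenPeriod t)))) (unitIdx L (fine (Lb * 1) (cubic (d + 1) (evenPeriod t))))) * (unitCovB L (fine (Lb * 1) (cubic (d + 1) (evenPeriod t))) a ha k)⁻¹))) * ((Matrix.of fun (x : idx L (fine (Lb * 1) (cubic (d + 1) (evenPeriod t))) 0) (q : idx L (fine (Lb * 1) (cubic (d + 1) (evenPeriod t))) 0 × idx L (fine (Lb * 1) (cubic (d + 1) (evenPeriod t))) 0) => avgTow (QBlev L (fine (Lb * 1) (cubic (d + 1) (evenPeriod t)))) ((L : ℝ) ^ (d + 1)) (fun k => calGlev L (fine (Lb * 1) (cubic (d + 1) (evenPeriod t))) a ha k * Pmodel L (fine (Lb * 1) (cubic (d + 1) (evenPeriod t))) (V t x) k * calGlev L (fine (Lb * 1) (cubic (d + 1) (evenPeriod t))) a ha k) k q.1 q.2))ᴴ) ((unitIdx L (fine (Lb * 1) (cubic (d + 1) (evenPeriod t)))).symm (z, μ')) ((unitIdx L (fine (Lb * 1) (cubic (d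 + 1) (evenPeriod t)))).symm (0, ν'))).re) (Pinf k)) ∧
      Beta.LimitRate.UniformDecay Pinf μ ν C ((κ₁ / 4) / (((d + 1 : ℕ)) : ℝ)) ∧
      StepRate Pinf μ ν C' ((κ₁ / 4) / (((d + 1 : ℕ)) : ℝ)) (Real.sqrt ((L : ℝ)⁻¹)) ∧
      (∃ K : KernelInputs (d + 1) Pinf, K.θ = Real.sqrt ((L : ℝ)⁻¹) ∧ K.c₀ = betaPrime510 (d + 1) (C' / (1 - Real.sqrt ((L : ℝ)⁻¹))) ((κ₁ / 4) / (((d + 1 : ℕ)) : ℝ)) ∧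
        K.Pinf = limKernelOf Pinf ∧ K.μ = μ ∧ K.ν = ν) ∧
      (∀ k, |B12Beta.secondMoment (Pinf k) μ ν - B12Beta.secondMoment (limKernelOf Pinf) μ ν|
          ≤ betaPrime510 (d + 1) (C' / (1 - Real.sqrt ((L : ℝ)⁻¹))) ((κ₁ / 4) / (((d + 1 : ℕ)) : ℝ)) * Real.sqrt ((L : ℝ)⁻¹) ^ k) := by
  obtain ⟨κΓ, B, B', hκΓ, hB, hB', henv⟩ := nestedLegs_envelopes L a ha Lb hL α c₀ hα
  obtain ⟨h1, h2⟩ := henv evenPeriod V hVb hdir hnest hloc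
  obtain ⟨κ₁, C, C', hκ₁, -, hC, hC', h⟩ := conv_oneLoop_loopCov_moving_of_rate (L := L) (Lb := Lb) (a := a) (ha := ha) (s := evenPeriod) hL (by omega)
    tendsto_evenPeriod (a' := 1) one_pos hne hκΓ
  obtain ⟨Pinf, hP⟩ := h B B B' B' hB hB hB' hB'
    (fun t k => (Matrix.of fun (x : idx L (fine (Lb * 1) (cubic (d + 1) (evenPeriod t))) 0) (q : idx L (fine (Lb * 1) (cubic (d + 1) (evenPeriod t))) 0 × idx L (fine (Lb * 1) (cubic (d + 1) (evenPeriod t))) 0) => avgTow (QBlev L (fine (Lb * 1) (cubic (d + 1) (evenPeriod t)))) ((L : ℝ) ^ (d + 1)) (fun k => calGlev L (fine (Lb * 1) (cubic (d + 1) (evenPeriod t))) a ha k * Pmodel L (fine (Lb * 1) (cubic (d + 1) (evenPeriod t))) (V t x) k * calGlev L (fine (Lb * 1) (cubic (d + 1) (evenPeriod t))) a ha k) k q.1 q.2))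
    (fun t k => (Matrix.of fun (x : idx L (fine (Lb * 1) (cubic (d + 1) (evenPeriod t))) 0) (q : idx L (fine (Lb * 1) (cubic (d + 1) (evenPeriod t))) 0 × idx L (fine (Lb * 1) (cubic (d + 1) (evenPeriod t))) 0) => avgTow (QBlev L (fine (Lb * 1) (cubic (d + 1) (evenPeriod t)))) ((L : ℝ) ^ (d + 1)) (fun k => calGlev L (fine (Lb * 1) (cubic (d + 1) (evenPeriod t))) a ha k * Pmodel L (fine (Lb * 1) (cubic (d + 1) (evenPeriod t))) (V t x) k * calGlev L (fine (Lb * 1) (cubic (d + 1) (evenPeriod t))) a ha k) k q.1 q.2))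
    h1 h1 h2 h2 (fun k μ' l l' z u v => boundedLegs_tendsto L Lb a ha hd hα hVb k (fun z μ' μ₀ f w => hel z μ' k μ₀ f w) μ' l l' z u v)
    (fun k μ' l l' z u v => boundedLegs_tendsto L Lb a ha hd hα hVb k (fun z μ' μ₀ f w => hel z μ' k μ₀ f w) μ' l l' z u v)
  exact ⟨κ₁, B * B * C, (B' * B + B * B') * C + B * B * C', hκ₁, by positivity, by positivity, Pinf, hP⟩

/-- **`conv_oneLoop_loopCov_blockIndicatorLegs` — V196's ONE-LOOP CONTRACTION END FOR THE BLOCK-INDICATOR 1-FORMS, NOTHING DISPLAYED** [our proof] (`d + 1 ≥ 3`, `L ≥ 2`,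
every `Lb ≥ 1`, `a > 0`, `μ ≠ ν`; the family `V_{t,x}^{(k)}(u)_μ = [μ = x₂]·𝟙[(prtk (prtQ L M_t) k u)₁ = x₁]` DISPLAYED as the hypothesis `hVdef`, no definition):
`conv_oneLoop_loopCov_nestedLegs` at `(α, c₀) = (1, 0)` fed with §2.  The indicator companion of PART 202's tent theorem: the first family of EXACT unit-block indicators for which
V196's loop contraction is an unconditional theorem. [cite: Balaban1987RG1, (1.20)–(1.22) p.264 (shapes)] -/
theorem conv_oneLoop_loopCov_blockIndicatorLegs (hL : 2 ≤ L) (hd : 2 ≤ d) {μ ν : Fin (d + 1)} (hne : μ ≠ ν)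
    {V : (t : ℕ) → idx L (fine (Lb * 1) (cubic (d + 1) (evenPeriod t))) 0 → (k : ℕ) → Fin (d + 1) → (idx L (fine (Lb * 1) (cubic (d + 1) (evenPeriod t))) k → ℂ)}
    (hVdef : ∀ t x k μ u, V t x k μ u = if μ = x.2 then (if (prtk (prtQ L (fine (Lb * 1) (cubic (d + 1) (evenPeriod t)))) k u).1 = x.1 then 1 else 0) else 0) :
    ∃ κ₁ C C' : ℝ, 0 < κ₁ ∧ 0 ≤ C ∧ 0 ≤ C' ∧ ∃ Pinf : ℕ → B12Beta.Kernel (d + 1),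
      (∀ k, IsInfiniteVolumeLimit (fun t => Lb * 1 * evenPeriod t)
        (fun t μ' ν' (z : Beta.Site (d + 1) (Lb * 1 * evenPeriod t)) => (((Matrix.of fun (x : idx L (fine (Lb * 1) (cubic (d + 1) (evenPeriod t))) 0) (q : idx L (fine (Lb * 1) (cubic (d + 1) (evenPeriod t))) 0 × idx L (fine (Lb * 1) (cubic (d + 1) (evenPeriod t))) 0) => avgTow (QBlev L (fine (Lb * 1) (cubic (d + 1) (evenPeriod t)))) ((L : ℝ) ^ (d + 1)) (fun k => calGlev L (fine (Lb * 1) (cubic (d + 1) (evenPeriod t))) a ha k * Pmodel L (fine (Lb * 1) (cubic (d + 1) (evenPeriod t))) (V t x) k * calGlev L (fine (Lb * 1) (cubic (d + 1) (evenPeriod t))) a ha k) k q.1 q.2) * ((((unitCovB L (fine (Lb * 1) (cubic (d + 1) (evenPeriod t))) a ha k)⁻¹ * (((flucCov (reM (DelK (lev L k) (one_le_lev' L k) (fine (Lb * 1) (cubic (d + 1) (evenPeriod t))) a ha)) (Matrix.fromRows (reM (QB 1 Lb (cubic (d + 1) (evenPeriod t)))) (fun (t' : {x : Tor (fine (Lb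 * 1) (cubic (d + 1) (evenPeriod t))) × Fin (d + 1) // (∀ ν, ν < x.2 → ((rem 1 Lb (cubic (d + 1) (evenPeriod t)) x.1 ν : ℕ)) = 0) ∧ ((rem 1 Lb (cubic (d + 1) (evenPeriod t)) x.1 x.2 : ℕ)) + 1 < Lb}) (x : Tor (fine (Lb * 1) (cubic (d + 1) (evenPeriod t))) × Fin (d + 1)) => if x = (Function.Embedding.subtype (fun x : Tor (fine (Lb * 1) (cubic (d + 1) (evenPeriod t))) × Fin (d + 1) => (∀ ν, ν < x.2 → ((rem 1 Lb (cubic (d + 1) (evenPeriod t)) x.1 ν : ℕ)) = 0) ∧ ((rem 1 Lb (cubic (d + 1) (evenPeriod t)) x.1 x.2 : ℕ)) + 1 < Lb)) t' then (1 : ℝ) else 0))).map ((↑) : ℝ → ℂ)).submatrix (unitIdx L (fine (Lb * 1) (cubic (d + 1) (evenPeriod t)))) (unitIdx L (fine (Lb * 1) (cubic (d + 1) (evenPeriod t))))) * (unitCovB L (fine (Lb * 1) (cubic (d + 1) (evenPeriod t))) a ha k)⁻¹)) ⊗ₖ (((unitCovB L (fine (Lb * 1) (cubic (d + 1) (evenPeriod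 t))) a ha k)⁻¹ * (((flucCov (reM (DelK (lev L k) (one_le_lev' L k) (fine (Lb * 1) (cubic (d + 1) (evenPeriod t))) a ha)) (Matrix.fromRows (reM (QB 1 Lb (cubic (d + 1) (evenPeriod t)))) (fun (t' : {x : Tor (fine (Lb * 1) (cubic (d + 1) (evenPeriod t))) × Fin (d + 1) // (∀ ν, ν < x.2 → ((rem 1 Lb (cubic (d + 1) (evenPeriod t)) x.1 ν : ℕ)) = 0) ∧ ((rem 1 Lb (cubic (d + 1) (evenPeriod t)) x.1 x.2 : ℕ)) + 1 < Lb}) (x : Tor (fine (Lb * 1) (cubic (d + 1) (evenPeriod t))) × Fin (d + 1)) => if x = (Function.Embedding.subtype (fun x : Tor (fine (Lb * 1) (cubic (d + 1) (evenPeriod t))) × Fin (d + 1) => (∀ ν, ν < x.2 → ((rem 1 Lb (cubic (d + 1) (evenPeriod t)) x.1 ν : ℕ)) = 0) ∧ ((rem 1 Lb (cubic (d + 1) (evenPeriod t)) x.1 x.2 : ℕ)) + 1 < Lb)) t' then (1 : ℝ) else 0))).map ((↑) : ℝ → ℂ)).submatrix (unitIdx L (fine (Lb * 1) (cubic (d +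 1) (evenPeriod t)))) (unitIdx L (fine (Lb * 1) (cubic (d + 1) (evenPeriod t))))) * (unitCovB L (fine (Lb * 1) (cubic (d + 1) (evenPeriod t))) a ha k)⁻¹))) * ((Matrix.of fun (x : idx L (fine (Lb * 1) (cubic (d + 1) (evenPeriod t))) 0) (q : idx L (fine (Lb * 1) (cubic (d + 1) (evenPeriod t))) 0 × idx L (fine (Lb * 1) (cubic (d + 1) (evenPeriod t))) 0) => avgTow (QBlev L (fine (Lb * 1) (cubic (d + 1) (evenPeriod t)))) ((L : ℝ) ^ (d + 1)) (fun k => calGlev L (fine (Lb * 1) (cubic (d + 1) (evenPeriod t))) a ha k * Pmodel L (fine (Lb * 1) (cubic (d + 1) (evenPeriod t))) (V t x) k * calGlev L (fine (Lb * 1) (cubic (d + 1) (evenPeriod t))) a ha k) k q.1 q.2))ᴴ) ((unitIdx L (fine (Lb * 1) (cubic (d + 1) (evenPeriod t)))).symm (z, μ')) ((unitIdx L (fine (Lb * 1) (cubic (d + 1) (evenPeriod t)))).symm (0, ν'))).re) (Pinf k)) ∧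
      Beta.LimitRate.UniformDecay Pinf μ ν C ((κ₁ / 4) / (((d + 1 : ℕ)) : ℝ)) ∧
      StepRate Pinf μ ν C' ((κ₁ / 4) / (((d + 1 : ℕ)) : ℝ)) (Real.sqrt ((L : ℝ)⁻¹)) ∧
      (∃ K : KernelInputs (d + 1) Pinf, K.θ = Real.sqrt ((L : ℝ)⁻¹) ∧ K.c₀ = betaPrime510 (d + 1) (C' / (1 - Real.sqrt ((L : ℝ)⁻¹))) ((κ₁ / 4) / (((d + 1 : ℕ)) : ℝ)) ∧
        K.Pinf = limKernelOf Pinf ∧ K.μ = μ ∧ K.ν = ν) ∧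
      (∀ k, |B12Beta.secondMoment (Pinf k) μ ν - B12Beta.secondMoment (limKernelOf Pinf) μ ν|
          ≤ betaPrime510 (d + 1) (C' / (1 - Real.sqrt ((L : ℝ)⁻¹))) ((κ₁ / 4) / (((d + 1 : ℕ)) : ℝ)) * Real.sqrt ((L : ℝ)⁻¹) ^ k) :=
  conv_oneLoop_loopCov_nestedLegs L Lb a ha hL hd hne (α := 1) (c₀ := 0) zero_le_one
    (fun t x k μ₀ u => blockIndicator_bound L (D := d + 1) (side := fun t => Lb * 1 * evenPeriod t) (V := V) hVdef t x k μ₀ u)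
    (fun t x k μ₀ u h => blockIndicator_dir L (D := d + 1) (side := fun t => Lb * 1 * evenPeriod t) (V := V) hVdef t x k μ₀ u h)
    (fun t x k u => blockIndicator_nest L (D := d + 1) (side := fun t => Lb * 1 * evenPeriod t) (V := V) hVdef t x k u)
    (fun t x k μ₀ u h => blockIndicator_loc L (D := d + 1) (side := fun t => Lb * 1 * evenPeriod t) (V := V) hVdef t x k μ₀ u h)
    (fun z μ' k μ₀ f w => tendsto_blockIndicator_reading L (D := d + 1) (side := fun t => Lb * 1 * evenPeriod t)
      (Filter.Tendsto.const_mul_atTop' (Nat.pos_of_ne_zero (NeZero.ne (Lb * 1))) tendsto_evenPeriod) (V := V) hVdef z μ' k μ₀ f w)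

end Summit.QuantumFields.BalabanUV.Beta.GAN24.NestedBlockIndicatorLegs

end
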